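import Literature.NumberTheory.EllipticCurves.Fisher2012.HesseFamilyFiveCongruence
import HarnessLib

/-!
# Fisher 2012, `n = 3`: closed forms of the Hesse polynomials, the syzygy, the dual family `X_E^-(3)`,
# and certificate-shaped corollaries

Companion to `Fisher2012/HesseFamilyFiveCongruence.lean` (whose appendix defines the `n = 3` Hesse
polynomials `hesseD3`, `hesseC4three`, `hesseC6three`, the pencil `hessePencil3` and the named fact
`thm132_threeCongruent_hessePencil` = Theorem 13.2, direction "if", `n = 3`). Written for the cell
`b2b-bsdres` (run/shared/lean/b2b/bsd-rank1-residual/), whose HONEST FRAMING applies to its use there: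
the goal of that cell is to DELETE the COMBINATION-SHAPED residual classes for ALL analytic-rank `≤ 1`
elliptic curves over `ℚ` — "full BSD formula for every rank `≤ 1` curve in class C" assembled STRICTLY
from published theorems — so that the rank-`≤ 1` remainder becomes exactly the CONSTRUCTION-SHAPED
classes, which are TYPED (missing-input `Prop`s), NOT attempted; this is not "finishing BSD".

Use in the cell: the instrument `translinks` v0.4 `X3E` (class-closure/eng-2/X3E-1.md) certifies a
mod-`3` congruence `W[3] ≅ G[3]` by exhibiting `G` as a member of the Hesse pencil of `W` (direct) or
of its DUAL pencil (reverse), i.e. by a rational point `(λ : μ)` and a scaling `u` with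
`𝔠₄(λ,μ) = u⁴ c₄(G)`, `𝔠₆(λ,μ) = u⁶ c₆(G)` (24 914 such certificates, 2026-08-21). This file supplies
what the kernel needs to CONSUME such a certificate: (1) the closed forms of `𝔠₄, 𝔠₆` for `n = 3`
(PROVED from the `pderiv` definitions, so a certificate is a `norm_num` identity), (2) the syzygy
(PROVED), (3) the dual family and the reverse analogue of Theorem 13.2 (DEFINITIONS + ONE NAMED FACT),
(4) corollaries turning `(λ, μ, u)` into a `Γ_ℚ`-equivariant `G[3] ≃+ W[3]` (PROVED modulo the facts).

## Source (T. Fisher, *The Hessian of a genus one curve*, Proc. LMS (3) 104 (2012) 613–648 = arXiv:math/0610403)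

§8, verbatim (case `n = 3`, `deg 𝔇 = 4`, `deg 𝔠₄ = 4n/(6−n) = 4`): "`𝔇(λ,μ) = λ⁴ − 6c₄λ²μ² − 8c₆λμ³ − 3c₄²μ⁴`",
"`𝔠₄(λ,μ) = −1/((deg 𝔇)²((deg 𝔇)−1)²) · |∂²𝔇/∂λ², ∂²𝔇/∂λ∂μ; ∂²𝔇/∂λ∂μ, ∂²𝔇/∂μ²|`",
"`𝔠₆(λ,μ) = 1/(deg 𝔇 · deg 𝔠₄) · |∂𝔇/∂λ, ∂𝔇/∂μ; ∂𝔠₄/∂λ, ∂𝔠₄/∂μ|`", "The Hesse polynomials are related by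
`𝔠₄(λ,μ)³ − 𝔠₆(λ,μ)² = (c₄³ − c₆²) 𝔇(λ,μ)ⁿ`." Expanding the two determinants (done below INSIDE the kernel):
`𝔠₄ = c₄λ⁴ + 4c₆λ³μ + 6c₄²λ²μ² + 4c₄c₆λμ³ + (4c₆² − 3c₄³)μ⁴`,
`𝔠₆ = c₆λ⁶ + 6c₄²λ⁵μ + 15c₄c₆λ⁴μ² + 20c₆²λ³μ³ + 15c₄²c₆λ²μ⁴ + (18c₄⁴ − 12c₄c₆²)λμ⁵ + (9c₄³c₆ − 8c₆³)μ⁶`.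
§9 (dual Hesse polynomials), verbatim for `n = 3`: "`𝔇(λ,μ) = −(c₄³−c₆²) 𝔠₄*(ξ,η)`,
`𝔠₄(λ,μ) = −(c₄³−c₆²)² 𝔇*(ξ,η)`, `𝔠₆(λ,μ) = −(c₄³−c₆²)² 𝔠₆*(ξ,η)` … where `λ = c₆ξ + c₄²η` and
`μ = −c₄ξ − c₆η`." §13, Definition 13.1: "directly `n`-congruent if there is an isomorphism of Galois
modules `E[n] ≅ E'[n]` that respects the Weil pairing … reverse `n`-congruent if there is an isomorphism of
Galois modules `ψ : E[n] ≅ E'[n]` satisfying `e_n(ψS,ψT) = e_n(S,T)⁻¹`"; Theorem 13.2 (`n = 2,3,4,5`;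
direct; stated in the companion file); and, verbatim: "The analogue of Theorem 13.2 for `X_E^-(n)` is
obtained by replacing the Hesse polynomials `𝔠₄(λ,μ)` and `𝔠₆(λ,μ)` by the dual Hesse polynomials
`τ⁻²𝔠₄*(ξ,η)` and `τ⁻³𝔠₆*(ξ,η)`" with "`τ = 1, 2, 12, 12⁴` for `n = 2, 3, 4, 5`" (§9, Thm. 9.2); §15.2
(worked examples `2006e1 ~ 2006d1` direct, `2541d1 ~ 2541c1` reverse).

## Transcription

* For `n = 3`, `τ = 2`: `τ⁻²𝔠₄* = −𝔇(λ,μ)/(4(c₄³−c₆²))` and `τ⁻³𝔠₆* = −𝔠₆(λ,μ)/(8(c₄³−c₆²)²)` with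
  `(λ, μ) = (c₆ξ + c₄²η, −c₄ξ − c₆η)`; since this substitution is an INVERTIBLE linear map over `ℚ`
  (determinant `c₄³ − c₆² = 1728Δ ≠ 0`), the reverse family is parametrised here directly by
  `(λ, μ) ∈ ℚ²`: `dualHessePencil3 c₄ c₆ l m := y² = x³ − 27·(−𝔇(l,m)/(4Δ′))x − 54·(−𝔠₆(l,m)/(8Δ′²))`,
  `Δ′ = c₄³ − c₆²` — the same SET of curves as print's `{E^-_{ξ,η}}`.
* NAMED FACT `thm132rev_threeCongruent_dualHessePencil` (PUB): the reverse analogue, direction "if",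
  `n = 3`, `K = ℚ`, conclusion = a `Γ_ℚ`-equivariant additive isomorphism of geometric `3`-torsion
  (the Weil-pairing clause "reverse" is DROPPED — weaker than print; it is all the cell's consumers
  (`TorsionIso`, Greenberg–Vatsal transfer, Selmer comparisons) use).
  `-- TODO(general form): fields of characteristic 0; the 'only if' directions; the Weil-pairing type.`
* PROVED (no fact): the closed forms `eval_hesseD3 / eval_hesseC4three / eval_hesseC6three` (kernel
  expansion of the printed Hessian/Jacobian determinants), the syzygy `hesse3_syzygy` (Fisher's
  displayed relation, `n = 3`), `𝔠₄(1,0) = c₄`, `𝔠₆(1,0) = c₆`, the transport of the reverse fact to an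
  arbitrary model, and the two CERTIFICATE corollaries `threeCongruent_of_hesseCertificate` /
  `threeCongruent_of_dualHesseCertificate`: numbers `l m u : ℚ`, `u ≠ 0`, with
  `𝔠₄(l,m) = u⁴·c₄(G)` and `𝔠₆(l,m) = u⁶·c₆(G)` (resp. the dual coefficients) give `G[3] ≃ W[3]`
  `Γ_ℚ`-equivariantly — because then `⟨u,0,0,0⟩ • (pencil member) = c4c6Model (c₄ G) (c₆ G) ≅ G`.
* Sanity outside the kernel (cell files class-closure/eng-2/X3E-1.md, code eng-2/code/x3e/): the closed
  forms and both families reproduce Fisher's §15.2 examples exactly ((λ:μ) = (521:9); (ξ:η) = (−55:1) ↔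
  (λ:μ) = (341:1)), agree pair-for-pair with Kuwata's independent universal families (arXiv:1112.6317,
  Thms 4.3/5.3) on 28 226 pairs, give NO member on 2 779 certified non-congruent pairs, and recover all
  23 293 Kraus–Oesterlé-certified `3`-congruences of the cell's tables.

## References
* T. Fisher, Proc. LMS (3) 104 (2012) 613–648, §8, §9, Def. 13.1, Thm. 13.2 and the `X_E^-(n)` paragraph
  of §13, §15.2. [Fisher2012Hessian]
* J. H. Silverman, AEC, III §1 (`c₄`, `c₆`, admissible changes of variables). [SilvermanAEC2009]
-/

set_option autoImplicit false

noncomputable section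

open scoped Classical

open MvPolynomial WeierstrassCurve

namespace Literature.NumberTheory.EllipticCurves.Fisher2012

/-! ### Closed forms of the `n = 3` Hesse polynomials (kernel expansion of Fisher's determinants) -/

/-- `∂𝔇/∂λ = 4λ³ − 12c₄λμ² − 8c₆μ³` (`n = 3`). [cite: Fisher2012Hessian, §8 (Hesse polynomials, n = 3)] -/
theorem pderiv_zero_hesseD3 (c₄ c₆ : ℚ) :
    pderiv 0 (hesseD3 c₄ c₆) = C 4 * X 0 ^ 3 - C (12 * c₄) * X 0 * X 1 ^ 2 - C (8 * c₆) * X 1 ^ 3 := by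
  simp only [hesseD3, map_sub, pderiv_mul, pderiv_pow, pderiv_C, pderiv_X_self,
    pderiv_X_of_ne (i := (0 : Fin 2)) (j := 1) (by decide), Nat.cast_ofNat]
  simp only [map_mul, map_pow, map_ofNat]
  ring

/-- `∂𝔇/∂μ = −12c₄λ²μ − 24c₆λμ² − 12c₄²μ³` (`n = 3`). [cite: Fisher2012Hessian, §8 (Hesse polynomials, n = 3)] -/
theorem pderiv_one_hesseD3 (c₄ c₆ : ℚ) :
    pderiv 1 (hesseD3 c₄ c₆) =
      -(C (12 * c₄) * X 0 ^ 2 * X 1) - C (24 * c₆) * X 0 * X 1 ^ 2 - C (12 * c₄ ^ 2) * X 1 ^ 3 := by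
  simp only [hesseD3, map_sub, pderiv_mul, pderiv_pow, pderiv_C, pderiv_X_self,
    pderiv_X_of_ne (i := (1 : Fin 2)) (j := 0) (by decide), Nat.cast_ofNat]
  simp only [map_mul, map_pow, map_ofNat]
  ring

/-- The Hessian determinant of `𝔇` (`n = 3`) is `−144·(c₄λ⁴ + 4c₆λ³μ + 6c₄²λ²μ² + 4c₄c₆λμ³ + (4c₆² − 3c₄³)μ⁴)`.
[cite: Fisher2012Hessian, §8 (display defining 𝔠₄, n = 3)] -/
theorem hessianDet_hesseD3 (c₄ c₆ : ℚ) :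
    hessianDet (hesseD3 c₄ c₆) =
      C (-144) * (C c₄ * X 0 ^ 4 + C (4 * c₆) * X 0 ^ 3 * X 1 + C (6 * c₄ ^ 2) * X 0 ^ 2 * X 1 ^ 2
        + C (4 * c₄ * c₆) * X 0 * X 1 ^ 3 + C (4 * c₆ ^ 2 - 3 * c₄ ^ 3) * X 1 ^ 4) := by
  rw [hessianDet, pderiv_zero_hesseD3, pderiv_one_hesseD3]
  simp only [map_sub, map_neg, pderiv_mul, pderiv_pow, pderiv_C, pderiv_X_self,
    pderiv_X_of_ne (i := (0 : Fin 2)) (j := 1) (by decide),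
    pderiv_X_of_ne (i := (1 : Fin 2)) (j := 0) (by decide), Nat.cast_ofNat]
  simp only [map_mul, map_pow, map_ofNat]
  ring

/-- `𝔇(l,m) = l⁴ − 6c₄l²m² − 8c₆lm³ − 3c₄²m⁴` (`n = 3`), evaluated. [cite: Fisher2012Hessian, §8 (Hesse polynomials, n = 3)] -/
theorem eval_hesseD3 (c₄ c₆ l m : ℚ) :
    MvPolynomial.eval ![l, m] (hesseD3 c₄ c₆) =
      l ^ 4 - 6 * c₄ * l ^ 2 * m ^ 2 - 8 * c₆ * l * m ^ 3 - 3 * c₄ ^ 2 * m ^ 4 := by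
  simp only [hesseD3, map_sub, map_mul, map_pow, eval_C, eval_X, Matrix.cons_val_zero,
    Matrix.cons_val_one]

/-- **Closed form of `𝔠₄` for `n = 3`**: `𝔠₄(l,m) = c₄l⁴ + 4c₆l³m + 6c₄²l²m² + 4c₄c₆lm³ + (4c₆² − 3c₄³)m⁴`
— the kernel's own expansion of the printed `−(1/(4²·3²))·|Hessian(𝔇)|`.
[cite: Fisher2012Hessian, §8 (display defining 𝔠₄, n = 3)] -/
theorem eval_hesseC4three (c₄ c₆ l m : ℚ) :
    MvPolynomial.eval ![l, m] (hesseC4three c₄ c₆) =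
      c₄ * l ^ 4 + 4 * c₆ * l ^ 3 * m + 6 * c₄ ^ 2 * l ^ 2 * m ^ 2 + 4 * c₄ * c₆ * l * m ^ 3
        + (4 * c₆ ^ 2 - 3 * c₄ ^ 3) * m ^ 4 := by
  rw [hesseC4three, hessianDet_hesseD3]
  simp only [map_sub, map_mul, map_pow, map_add, map_neg, map_ofNat, eval_C, eval_X,
    Matrix.cons_val_zero, Matrix.cons_val_one]
  ring

/-- The Jacobian determinant `|∂𝔇/∂λ, ∂𝔇/∂μ; ∂𝔠₄/∂λ, ∂𝔠₄/∂μ|` for `n = 3`, as `C(−1/144)` times an explicit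
sextic (`= 16·𝔠₆`). [cite: Fisher2012Hessian, §8 (display defining 𝔠₆, n = 3)] -/
theorem jacobianDet_hesseD3 (c₄ c₆ : ℚ) :
    jacobianDet (hesseD3 c₄ c₆) (hesseC4three c₄ c₆) =
      C (-1 / (4 ^ 2 * 3 ^ 2 : ℚ)) * (C (-2304) * (C c₆ * X 0 ^ 6 + C (6 * c₄ ^ 2) * X 0 ^ 5 * X 1
        + C (15 * c₄ * c₆) * X 0 ^ 4 * X 1 ^ 2 + C (20 * c₆ ^ 2) * X 0 ^ 3 * X 1 ^ 3
        + C (15 * c₄ ^ 2 * c₆) * X 0 ^ 2 * X 1 ^ 4 + C (18 * c₄ ^ 4 - 12 * c₄ * c₆ ^ 2) * X 0 * X 1 ^ 5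
        + C (9 * c₄ ^ 3 * c₆ - 8 * c₆ ^ 3) * X 1 ^ 6)) := by
  rw [jacobianDet, hesseC4three, pderiv_C_mul, pderiv_C_mul, hessianDet_hesseD3, pderiv_zero_hesseD3,
    pderiv_one_hesseD3]
  simp only [map_sub, map_add, map_neg, pderiv_mul, pderiv_pow, pderiv_C, pderiv_X_self,
    pderiv_X_of_ne (i := (0 : Fin 2)) (j := 1) (by decide),
    pderiv_X_of_ne (i := (1 : Fin 2)) (j := 0) (by decide), Nat.cast_ofNat]
  simp only [map_mul, map_pow, map_ofNat]
  ring

/-- **Closed form of `𝔠₆` for `n = 3`**: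
`𝔠₆(l,m) = c₆l⁶ + 6c₄²l⁵m + 15c₄c₆l⁴m² + 20c₆²l³m³ + 15c₄²c₆l²m⁴ + (18c₄⁴ − 12c₄c₆²)lm⁵ + (9c₄³c₆ − 8c₆³)m⁶`
— the kernel's own expansion of the printed `(1/(4·4))·|∂𝔇/∂λ, ∂𝔇/∂μ; ∂𝔠₄/∂λ, ∂𝔠₄/∂μ|`.
[cite: Fisher2012Hessian, §8 (display defining 𝔠₆, n = 3)] -/
theorem eval_hesseC6three (c₄ c₆ l m : ℚ) :
    MvPolynomial.eval ![l, m] (hesseC6three c₄ c₆) =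
      c₆ * l ^ 6 + 6 * c₄ ^ 2 * l ^ 5 * m + 15 * c₄ * c₆ * l ^ 4 * m ^ 2 + 20 * c₆ ^ 2 * l ^ 3 * m ^ 3
        + 15 * c₄ ^ 2 * c₆ * l ^ 2 * m ^ 4 + (18 * c₄ ^ 4 - 12 * c₄ * c₆ ^ 2) * l * m ^ 5
        + (9 * c₄ ^ 3 * c₆ - 8 * c₆ ^ 3) * m ^ 6 := by
  rw [hesseC6three, jacobianDet_hesseD3]
  simp only [map_sub, map_mul, map_pow, map_add, map_neg, map_ofNat, eval_C, eval_X,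
    Matrix.cons_val_zero, Matrix.cons_val_one]
  ring

/-- **The syzygy, `n = 3`** (Fisher's displayed relation between the Hesse polynomials):
`𝔠₄(l,m)³ − 𝔠₆(l,m)² = (c₄³ − c₆²)·𝔇(l,m)³`; PROVED by the closed forms. It says the member
`E_{λ,μ}` has discriminant `Δ·𝔇(λ,μ)³` (Remark 8.6), so it is singular exactly at the roots of `𝔇`.
[cite: Fisher2012Hessian, §8 (the relation 𝔠₄³ − 𝔠₆² = (c₄³ − c₆²)𝔇ⁿ, n = 3)] -/
theorem hesse3_syzygy (c₄ c₆ l m : ℚ) :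
    MvPolynomial.eval ![l, m] (hesseC4three c₄ c₆) ^ 3 - MvPolynomial.eval ![l, m] (hesseC6three c₄ c₆) ^ 2 =
      (c₄ ^ 3 - c₆ ^ 2) * MvPolynomial.eval ![l, m] (hesseD3 c₄ c₆) ^ 3 := by
  rw [eval_hesseC4three, eval_hesseC6three, eval_hesseD3]
  ring

/-- `𝔠₄(1,0) = c₄`, `𝔠₆(1,0) = c₆`: the member at `(λ:μ) = (1:0)` is `E` itself (Thm. 8.5,
`c₄(λU + μH) = 𝔠₄(λ,μ)` at `μ = 0`). [cite: Fisher2012Hessian, Thm. 8.5 (n = 3)] -/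
theorem hessePencil3_one_zero (c₄ c₆ : ℚ) : hessePencil3 c₄ c₆ 1 0 = c4c6Model c₄ c₆ := by
  simp only [hessePencil3, c4c6Model, eval_hesseC4three, eval_hesseC6three]
  ext <;> ring

/-! ### The dual family `X_E^-(3)` (Fisher §9 + §13) -/

/-- The member of the DUAL Hesse pencil of `E : y² = x³ − 27c₄x − 54c₆` for `n = 3` (the family
parametrised by `X_E^-(3) ≅ ℙ¹`, curves REVERSE `3`-congruent to `E`):
`y² = x³ − 27·(τ⁻²𝔠₄*)x − 54·(τ⁻³𝔠₆*)` with `τ = 2`, `τ⁻²𝔠₄* = −𝔇(λ,μ)/(4(c₄³−c₆²))`,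
`τ⁻³𝔠₆* = −𝔠₆(λ,μ)/(8(c₄³−c₆²)²)`, written in the parameter `(λ, μ) = (c₆ξ + c₄²η, −c₄ξ − c₆η)`
(an invertible substitution), at `(λ, μ) = (l, m)`.
[cite: Fisher2012Hessian, §9 (dual Hesse polynomials, n = 3) and §13 (the X_E^-(n) analogue of Thm. 13.2, τ = 2)] -/
def dualHessePencil3 (c₄ c₆ l m : ℚ) : WeierstrassCurve ℚ :=
  ⟨0, 0, 0, -27 * (-MvPolynomial.eval ![l, m] (hesseD3 c₄ c₆) / (4 * (c₄ ^ 3 - c₆ ^ 2))),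
    -54 * (-MvPolynomial.eval ![l, m] (hesseC6three c₄ c₆) / (8 * (c₄ ^ 3 - c₆ ^ 2) ^ 2))⟩

/-- **Fisher 2012, §13: the analogue of Theorem 13.2 for `X_E^-(n)`, direction "if", `n = 3`, `K = ℚ`.**
Every NON-SINGULAR member of the dual Hesse pencil of the elliptic curve `E : y² = x³ − 27c₄x − 54c₆`
(`λ, μ ∈ ℚ`) is `3`-congruent to `E` — there is an isomorphism of `Γ_ℚ`-modules `E^-_{λ,μ}[3] ≅ E[3]`
(print: "reverse `3`-congruent", i.e. inverting the Weil pairing; that clause is dropped). NAMED FACT,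
not proved here. [cite: Fisher2012Hessian, §13 (analogue of Thm. 13.2 for X_E^-(n), n = 3; with §9 and Def. 13.1)] -/
def thm132rev_threeCongruent_dualHessePencil : Prop :=
  ∀ (c₄ c₆ l m : ℚ) [(c4c6Model c₄ c₆).IsElliptic] [(dualHessePencil3 c₄ c₆ l m).IsElliptic],
    ∃ e : geomTorsion (dualHessePencil3 c₄ c₆ l m) (3 : ℤ) ≃+ geomTorsion (c4c6Model c₄ c₆) (3 : ℤ),
      ∀ (σ : Field.absoluteGaloisGroup ℚ) (P : geomTorsion (dualHessePencil3 c₄ c₆ l m) (3 : ℤ)),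
        e (σ • P) = σ • e P

/-- **Transport of the reverse fact to any model.** For every elliptic curve `W/ℚ` and every non-singular
member of the dual `n = 3` Hesse pencil of its `c₄,c₆`-model, `E^-_{λ,μ}[3] ≅ W[3]` as `Γ_ℚ`-modules.
Conditional on the named fact `thm132rev_threeCongruent_dualHessePencil`; the transport is proved.
[cite: Fisher2012Hessian, §13 (analogue of Thm. 13.2 for X_E^-(n))] -/
theorem threeCongruent_dualHessePencil3 (hF : thm132rev_threeCongruent_dualHessePencil)
    (W : WeierstrassCurve ℚ) [W.IsElliptic] (l m : ℚ) [(dualHessePencil3 W.c₄ W.c₆ l m).IsElliptic] :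
    ∃ e : geomTorsion (dualHessePencil3 W.c₄ W.c₆ l m) (3 : ℤ) ≃+ geomTorsion W (3 : ℤ),
      ∀ (σ : Field.absoluteGaloisGroup ℚ) (P : geomTorsion (dualHessePencil3 W.c₄ W.c₆ l m) (3 : ℤ)),
        e (σ • P) = σ • e P := by
  obtain ⟨e₁, he₁⟩ := hF W.c₄ W.c₆ l m
  obtain ⟨e₂, he₂⟩ := exists_geomTorsion_addEquiv_c4c6Model W 3
  refine ⟨e₁.trans e₂.symm, fun σ P => ?_⟩
  simp only [AddEquiv.trans_apply]
  apply e₂.injective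
  rw [AddEquiv.apply_symm_apply, he₂, AddEquiv.apply_symm_apply, he₁]

/-! ### Certificates: a rational point of `X_W(3)` / `X_W^-(3)` mapping to `G` gives `G[3] ≅ W[3]` -/

/-- Scaling lemma: if the short Weierstrass curve `⟨0,0,0,a₄,a₆⟩` has `a₄ = −27·u⁴·c₄(G)` and
`a₆ = −54·u⁶·c₆(G)` with `u ≠ 0`, then the change of variables `(u; 0,0,0)` carries it to the
`c₄,c₆`-model of `G`. [cite: SilvermanAEC2009, III §1 (Table 3.1: u⁴a₄′ = a₄, u⁶a₆′ = a₆ when r = s = t = 0)] -/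
theorem variableChange_shortModel_eq_c4c6Model (G : WeierstrassCurve ℚ) (a₄ a₆ u : ℚ) (hu : u ≠ 0)
    (h4 : a₄ = -27 * (u ^ 4 * G.c₄)) (h6 : a₆ = -54 * (u ^ 6 * G.c₆)) :
    (⟨Units.mk0 u hu, 0, 0, 0⟩ : VariableChange ℚ) • (⟨0, 0, 0, a₄, a₆⟩ : WeierstrassCurve ℚ) =
      c4c6Model G.c₄ G.c₆ := by
  have hui : ((Units.mk0 u hu)⁻¹ : ℚˣ) = (u⁻¹ : ℚ) := by
    rw [Units.val_inv_eq_inv_val, Units.val_mk0]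
  ext
  · rw [variableChange_a₁]; simp [c4c6Model]
  · rw [variableChange_a₂]; simp [c4c6Model]
  · rw [variableChange_a₃]; simp [c4c6Model]
  · rw [variableChange_a₄, hui, h4]; simp only [c4c6Model]; field_simp; ring
  · rw [variableChange_a₆, hui, h6]; simp only [c4c6Model]; field_simp; ring

/-- From a change of variables `C • P = c4c6Model (c₄ G) (c₆ G)` and an equivariant `P[3] ≃ W[3]`, an
equivariant `G[3] ≃ W[3]` (composition of three isomorphisms; proved; private plumbing). [folklore] -/
private theorem threeCongruent_of_variableChange_eq_c4c6Model (W G P : WeierstrassCurve ℚ) (C : VariableChange ℚ)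
    (hC : C • P = c4c6Model G.c₄ G.c₆)
    (hP : ∃ e : geomTorsion P (3 : ℤ) ≃+ geomTorsion W (3 : ℤ),
      ∀ (σ : Field.absoluteGaloisGroup ℚ) (Q : geomTorsion P (3 : ℤ)), e (σ • Q) = σ • e Q) :
    ∃ e : geomTorsion G (3 : ℤ) ≃+ geomTorsion W (3 : ℤ),
      ∀ (σ : Field.absoluteGaloisGroup ℚ) (Q : geomTorsion G (3 : ℤ)), e (σ • Q) = σ • e Q := by
  obtain ⟨e₁, he₁⟩ := hP
  obtain ⟨e₂, he₂⟩ := exists_geomTorsion_addEquiv_c4c6Model G 3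
  have h₃ := P.exists_geomTorsion_addEquiv_smul C 3
  rw [hC] at h₃
  obtain ⟨e₃, he₃⟩ := h₃
  refine ⟨(e₂.trans e₃.symm).trans e₁, fun σ Q => ?_⟩
  simp only [AddEquiv.trans_apply]
  rw [← he₁]
  congr 1
  apply e₃.injective
  rw [AddEquiv.apply_symm_apply, he₃, AddEquiv.apply_symm_apply, he₂]

/-- **Certificate, direct kind.** Let `W, G` be elliptic curves over `ℚ` and `l m u : ℚ`, `u ≠ 0`, with
`𝔠₄(l,m) = u⁴·c₄(G)` and `𝔠₆(l,m) = u⁶·c₆(G)` (Hesse polynomials of `W`, `n = 3`; by `eval_hesseC4three`,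
`eval_hesseC6three` these are two polynomial identities in `ℚ`, i.e. `G` is `ℚ`-isomorphic to the member
`E_{l,m}` of the Hesse pencil of `W`). Then `G[3] ≅ W[3]` as `Γ_ℚ`-modules. Conditional on Fisher's
Theorem 13.2 (`n = 3`) as the named fact `thm132_threeCongruent_hessePencil`; everything else proved.
[cite: Fisher2012Hessian, Thm. 13.2 (n = 3)] -/
theorem threeCongruent_of_hesseCertificate (hF : thm132_threeCongruent_hessePencil)
    (W G : WeierstrassCurve ℚ) [W.IsElliptic] [G.IsElliptic] (l m u : ℚ) (hu : u ≠ 0)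
    (h4 : MvPolynomial.eval ![l, m] (hesseC4three W.c₄ W.c₆) = u ^ 4 * G.c₄)
    (h6 : MvPolynomial.eval ![l, m] (hesseC6three W.c₄ W.c₆) = u ^ 6 * G.c₆) :
    ∃ e : geomTorsion G (3 : ℤ) ≃+ geomTorsion W (3 : ℤ),
      ∀ (σ : Field.absoluteGaloisGroup ℚ) (Q : geomTorsion G (3 : ℤ)), e (σ • Q) = σ • e Q := by
  have hC : (⟨Units.mk0 u hu, 0, 0, 0⟩ : VariableChange ℚ) • hessePencil3 W.c₄ W.c₆ l m =
      c4c6Model G.c₄ G.c₆ :=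
    variableChange_shortModel_eq_c4c6Model G _ _ u hu (by rw [h4]) (by rw [h6])
  haveI : (hessePencil3 W.c₄ W.c₆ l m).IsElliptic := by
    rw [← inv_smul_smul (⟨Units.mk0 u hu, 0, 0, 0⟩ : VariableChange ℚ) (hessePencil3 W.c₄ W.c₆ l m), hC]
    infer_instance
  exact threeCongruent_of_variableChange_eq_c4c6Model W G _ _ hC (threeCongruent_hessePencil3 hF W l m)

/-- **Certificate, reverse kind.** Let `W, G` be elliptic curves over `ℚ`, `Δ′ = c₄(W)³ − c₆(W)²`, and
`l m u : ℚ`, `u ≠ 0`, with `−𝔇(l,m)/(4Δ′) = u⁴·c₄(G)` and `−𝔠₆(l,m)/(8Δ′²) = u⁶·c₆(G)` (so `G` is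
`ℚ`-isomorphic to the member `E^-_{l,m}` of the DUAL Hesse pencil of `W`). Then `G[3] ≅ W[3]` as
`Γ_ℚ`-modules. Conditional on the named fact `thm132rev_threeCongruent_dualHessePencil`.
[cite: Fisher2012Hessian, §13 (analogue of Thm. 13.2 for X_E^-(3))] -/
theorem threeCongruent_of_dualHesseCertificate (hF : thm132rev_threeCongruent_dualHessePencil)
    (W G : WeierstrassCurve ℚ) [W.IsElliptic] [G.IsElliptic] (l m u : ℚ) (hu : u ≠ 0)
    (h4 : -MvPolynomial.eval ![l, m] (hesseD3 W.c₄ W.c₆) / (4 * (W.c₄ ^ 3 - W.c₆ ^ 2)) = u ^ 4 * G.c₄)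
    (h6 : -MvPolynomial.eval ![l, m] (hesseC6three W.c₄ W.c₆) / (8 * (W.c₄ ^ 3 - W.c₆ ^ 2) ^ 2) =
      u ^ 6 * G.c₆) :
    ∃ e : geomTorsion G (3 : ℤ) ≃+ geomTorsion W (3 : ℤ),
      ∀ (σ : Field.absoluteGaloisGroup ℚ) (Q : geomTorsion G (3 : ℤ)), e (σ • Q) = σ • e Q := by
  have hC : (⟨Units.mk0 u hu, 0, 0, 0⟩ : VariableChange ℚ) • dualHessePencil3 W.c₄ W.c₆ l m =
      c4c6Model G.c₄ G.c₆ :=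
    variableChange_shortModel_eq_c4c6Model G _ _ u hu (by rw [h4]) (by rw [h6])
  haveI : (dualHessePencil3 W.c₄ W.c₆ l m).IsElliptic := by
    rw [← inv_smul_smul (⟨Units.mk0 u hu, 0, 0, 0⟩ : VariableChange ℚ) (dualHessePencil3 W.c₄ W.c₆ l m),
      hC]
    infer_instance
  exact threeCongruent_of_variableChange_eq_c4c6Model W G _ _ hC
    (threeCongruent_dualHessePencil3 hF W l m)

end Literature.NumberTheory.EllipticCurves.Fisher2012

end
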